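import Summits.Ventures.DiscreteObjects.Hadamard.Order167ItoTypeIff668B
import Summits.Ventures.DiscreteObjects.Hadamard.WilliamsonSequences167Iff668
import Literature.Combinatorics.Designs.ItoArray

/-!
# H(668): σ₁₆₇ + centralising involution + fixed-point-free inverting coset ⇔ an ITO-TYPE Hadamard matrix `itoMatrix a b c d`
# (Literature `ItoArray`, Balonin–Đoković 2015 §9 / Ito 1981) with circulant blocks of order 167 (kernel iff)

Framing: lottery ticket; floor = certified bounds/negative ranges.

Cell pub-namedobj (venture DiscreteObjects), target (H), hadamard gen 22.  `Order167ItoTypeIff668B` proved the automorphism iff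
with the right-hand side 'the `V₄`-twisted array `[θ_W(g,h) · A_{g+h}(ε_g (t − s))]` is Hadamard'.  Here that array is identified
with the published object: **`itoThetaWArray_eq_itoMatrix`** — entrywise it IS the Literature matrix
`itoMatrix a b c d = (A B C D / −B A −D C / −Cᵀ Dᵀ Aᵀ −Bᵀ / −Dᵀ −Cᵀ Bᵀ Aᵀ)` on the REVERSED sequences `a(r) = A_0(−r), …`
(Mathlib's `circulant v i j = v (i − j)`), re-indexed along `V₄ ≃ Fin 4` (`0 ↦ 0, (1,0) ↦ 1, (0,1) ↦ 2, (1,1) ↦ 3`); hence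
(any `n`) **`itoThetaWArray_iff_itoMatrix`**: (∃ `A`, the twisted array is Hadamard) ⇔ (∃ `a b c d`, `itoMatrix a b c d` is
Hadamard); and **`hadamard668_ito_iff_itoMatrix`**: **(∃ H(668) with a signed automorphism `σ` of order 167, a signed automorphism
commuting with it whose pair is a non-trivial involution, and a signed automorphism `ρ` inverting `σ` with `ρ`, `ρτ` fixing no
row) ⇔ (∃ `a b c d : ℤ/167 → ℤ` with `itoMatrix a b c d` a Hadamard matrix of order 668 — an Ito-type / quasi-Williamson
quadruple of order 167)**.  By Balonin–Đoković 2015 §9 (not formalised here) the right-hand side is further equivalent to a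
negaperiodic Golay pair of length 334 and to an Ito relative difference set in the dicyclic group of order 1336.  DICTIONARY; both
sides OPEN (Ito's conjecture at `w = 167`); H(668) untouched; HITS 0/4.  Ours (the array is the published one); no `sorry`, no
definitions, default heartbeats.
-/

namespace Summit.Ventures.DiscreteObjects.Hadamard

open Finset BigOperators Matrix

open Literature.Combinatorics.Designs.GoethalsSeidel (IsHadamardMatrix)
open Literature.Combinatorics.Designs.ItoArray (itoMatrix itoBlocks)

section anyorder
variable {n : ℕ}

/-- the sixteen blocks of the Literature matrix `itoMatrix a b c d`, entrywise (definitional) -/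
lemma itoMatrix_circulant_entries (a b c d : ZMod n → ℤ) (s t : ZMod n) :
    (itoMatrix a b c d (0, s) (0, t) = a (s - t) ∧ itoMatrix a b c d (0, s) (1, t) = b (s - t) ∧
      itoMatrix a b c d (0, s) (2, t) = c (s - t) ∧ itoMatrix a b c d (0, s) (3, t) = d (s - t)) ∧
    (itoMatrix a b c d (1, s) (0, t) = -b (s - t) ∧ itoMatrix a b c d (1, s) (1, t) = a (s - t) ∧
      itoMatrix a b c d (1, s) (2, t) = -d (s - t) ∧ itoMatrix a b c d (1, s) (3, t) = c (s - t)) ∧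
    (itoMatrix a b c d (2, s) (0, t) = -c (-(s - t)) ∧ itoMatrix a b c d (2, s) (1, t) = d (-(s - t)) ∧
      itoMatrix a b c d (2, s) (2, t) = a (-(s - t)) ∧ itoMatrix a b c d (2, s) (3, t) = -b (-(s - t))) ∧
    (itoMatrix a b c d (3, s) (0, t) = -d (-(s - t)) ∧ itoMatrix a b c d (3, s) (1, t) = -c (-(s - t)) ∧
      itoMatrix a b c d (3, s) (2, t) = b (-(s - t)) ∧ itoMatrix a b c d (3, s) (3, t) = a (-(s - t))) :=
  ⟨⟨rfl, rfl, rfl, rfl⟩, ⟨rfl, rfl, rfl, rfl⟩, ⟨rfl, rfl, rfl, rfl⟩, ⟨rfl, rfl, rfl, rfl⟩⟩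

/-- **the twisted `θ_W`-array with transposed inverting block-rows IS the Literature Ito matrix on the reversed sequences**
(entrywise, along `V₄ → Fin 4`) -/
theorem itoThetaWArray_eq_itoMatrix (A : ZMod 2 × ZMod 2 → ZMod n → ℤ) (a b : (ZMod 2 × ZMod 2) × ZMod n) :
    (if a.1 = 0 then (1 : ℤ) else if a.1 = (1, 0) then (if b.1.1 = 1 then 1 else -1)
        else if a.1 = (0, 1) then (if b.1.1 = b.1.2 then -1 else 1) else (if b.1.2 = 1 then 1 else -1)) *
      A (a.1 + b.1) (if a.1.2 = 0 then b.2 - a.2 else a.2 - b.2) =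
    itoMatrix (fun r => A (0, 0) (-r)) (fun r => A (1, 0) (-r)) (fun r => A (0, 1) (-r)) (fun r => A (1, 1) (-r))
      ((if a.1 = 0 then (0 : Fin 4) else if a.1 = (1, 0) then 1 else if a.1 = (0, 1) then 2 else 3), a.2)
      ((if b.1 = 0 then (0 : Fin 4) else if b.1 = (1, 0) then 1 else if b.1 = (0, 1) then 2 else 3), b.2) := by
  obtain ⟨g, s⟩ := a
  obtain ⟨h, t⟩ := b
  obtain ⟨⟨e00, e01, e02, e03⟩, ⟨e10, e11, e12, e13⟩, ⟨e20, e21, e22, e23⟩, ⟨e30, e31, e32, e33⟩⟩ :=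
    itoMatrix_circulant_entries (fun r => A (0, 0) (-r)) (fun r => A (1, 0) (-r)) (fun r => A (0, 1) (-r))
      (fun r => A (1, 1) (-r)) s t
  have s1 : ((1, 0) : ZMod 2 × ZMod 2) + (1, 0) = (0, 0) := by decide
  have s2 : ((1, 0) : ZMod 2 × ZMod 2) + (0, 1) = (1, 1) := by decide
  have s3 : ((1, 0) : ZMod 2 × ZMod 2) + (1, 1) = (0, 1) := by decide
  have s4 : ((0, 1) : ZMod 2 × ZMod 2) + (1, 0) = (1, 1) := by decide
  have s5 : ((0, 1) : ZMod 2 × ZMod 2) + (0, 1) = (0, 0) := by decide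
  have s6 : ((0, 1) : ZMod 2 × ZMod 2) + (1, 1) = (1, 0) := by decide
  have s7 : ((1, 1) : ZMod 2 × ZMod 2) + (1, 0) = (0, 1) := by decide
  have s8 : ((1, 1) : ZMod 2 × ZMod 2) + (0, 1) = (1, 0) := by decide
  have s9 : ((1, 1) : ZMod 2 × ZMod 2) + (1, 1) = (0, 0) := by decide
  have s10 : ((0, 0) : ZMod 2 × ZMod 2) + (0, 0) = (0, 0) := by decide
  have s11 : ((0, 0) : ZMod 2 × ZMod 2) + (1, 0) = (1, 0) := by decide
  have s12 : ((0, 0) : ZMod 2 × ZMod 2) + (0, 1) = (0, 1) := by decide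
  have s13 : ((0, 0) : ZMod 2 × ZMod 2) + (1, 1) = (1, 1) := by decide
  have s14 : ((1, 0) : ZMod 2 × ZMod 2) + (0, 0) = (1, 0) := by decide
  have s15 : ((0, 1) : ZMod 2 × ZMod 2) + (0, 0) = (0, 1) := by decide
  have s16 : ((1, 1) : ZMod 2 × ZMod 2) + (0, 0) = (1, 1) := by decide
  have t0 : (0 : ZMod 2 × ZMod 2) = (0, 0) := rfl
  have t1 : ((1, 0) : ZMod 2 × ZMod 2) ≠ (0, 0) := by decide
  have t2 : ((0, 1) : ZMod 2 × ZMod 2) ≠ (0, 0) := by decide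
  have t3 : ((1, 1) : ZMod 2 × ZMod 2) ≠ (0, 0) := by decide
  have t4 : ((0, 1) : ZMod 2 × ZMod 2) ≠ (1, 0) := by decide
  have t5 : ((1, 1) : ZMod 2 × ZMod 2) ≠ (1, 0) := by decide
  have t6 : ((1, 1) : ZMod 2 × ZMod 2) ≠ (0, 1) := by decide
  have t7 : ((1, 0) : ZMod 2 × ZMod 2) ≠ (0, 1) := by decide
  have z01 : (0 : ZMod 2) ≠ 1 := by decide
  have z10 : (1 : ZMod 2) ≠ 0 := by decide
  simp only [t0]
  rcases v4_cases g with rfl | rfl | rfl | rfl <;> rcases v4_cases h with rfl | rfl | rfl | rfl <;>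
    simp only [s1, s2, s3, s4, s5, s6, s7, s8, s9, s10, s11, s12, s13, s14, s15, s16, t1, t2, t3, t4, t5, t6, t7,
      z01, z10, if_true, if_false, one_mul, neg_mul, e00, e01, e02, e03, e10, e11, e12, e13, e20, e21, e22, e23, e30,
      e31, e32, e33, neg_sub]

/-- **twisted-array Hadamard ⇔ Literature Ito matrix Hadamard** (any order `n`). -/
theorem itoThetaWArray_iff_itoMatrix [NeZero n] :
    (∃ A : ZMod 2 × ZMod 2 → ZMod n → ℤ,
      IsHadamardMatrix (Matrix.of fun (a b : (ZMod 2 × ZMod 2) × ZMod n) =>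
        (if a.1 = 0 then (1 : ℤ) else if a.1 = (1, 0) then (if b.1.1 = 1 then 1 else -1)
          else if a.1 = (0, 1) then (if b.1.1 = b.1.2 then -1 else 1) else (if b.1.2 = 1 then 1 else -1)) *
        A (a.1 + b.1) (if a.1.2 = 0 then b.2 - a.2 else a.2 - b.2))) ↔
    ∃ a b c d : ZMod n → ℤ, IsHadamardMatrix (itoMatrix a b c d) := by
  -- the re-indexing V₄ × ℤ/n ≃ Fin 4 × ℤ/n
  let f : (ZMod 2 × ZMod 2) × ZMod n → Fin 4 × ZMod n := fun x =>
    ((if x.1 = 0 then (0 : Fin 4) else if x.1 = (1, 0) then 1 else if x.1 = (0, 1) then 2 else 3), x.2)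
  have hf : Function.Bijective f := by
    rw [Fintype.bijective_iff_injective_and_card]
    refine ⟨?_, by simp [ZMod.card]⟩
    rintro ⟨g, s⟩ ⟨h, t⟩ hgh
    simp only [f, Prod.mk.injEq] at hgh
    obtain ⟨h1, rfl⟩ := hgh
    rw [v4_fin4_injective h1]
  have heq : ∀ A : ZMod 2 × ZMod 2 → ZMod n → ℤ,
      (Matrix.of fun (a' b' : (ZMod 2 × ZMod 2) × ZMod n) =>
        (if a'.1 = 0 then (1 : ℤ) else if a'.1 = (1, 0) then (if b'.1.1 = 1 then 1 else -1)
          else if a'.1 = (0, 1) then (if b'.1.1 = b'.1.2 then -1 else 1) else (if b'.1.2 = 1 then 1 else -1)) *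
        A (a'.1 + b'.1) (if a'.1.2 = 0 then b'.2 - a'.2 else a'.2 - b'.2)) =
      (itoMatrix (fun r => A (0, 0) (-r)) (fun r => A (1, 0) (-r)) (fun r => A (0, 1) (-r))
        (fun r => A (1, 1) (-r))).submatrix (Equiv.ofBijective f hf) (Equiv.ofBijective f hf) := by
    intro A
    ext a' b'
    rw [Matrix.of_apply, Matrix.submatrix_apply, Equiv.ofBijective_apply, Equiv.ofBijective_apply,
      itoThetaWArray_eq_itoMatrix A a' b']
  constructor
  · rintro ⟨A, hW⟩
    refine ⟨fun r => A (0, 0) (-r), fun r => A (1, 0) (-r), fun r => A (0, 1) (-r), fun r => A (1, 1) (-r), ?_⟩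
    have hback : itoMatrix (fun r => A (0, 0) (-r)) (fun r => A (1, 0) (-r)) (fun r => A (0, 1) (-r))
        (fun r => A (1, 1) (-r)) =
        (Matrix.of fun (a' b' : (ZMod 2 × ZMod 2) × ZMod n) =>
          (if a'.1 = 0 then (1 : ℤ) else if a'.1 = (1, 0) then (if b'.1.1 = 1 then 1 else -1)
            else if a'.1 = (0, 1) then (if b'.1.1 = b'.1.2 then -1 else 1) else (if b'.1.2 = 1 then 1 else -1)) *
          A (a'.1 + b'.1) (if a'.1.2 = 0 then b'.2 - a'.2 else a'.2 - b'.2)).submatrix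
          (Equiv.ofBijective f hf).symm (Equiv.ofBijective f hf).symm := by
      rw [heq A, Matrix.submatrix_submatrix, Equiv.self_comp_symm, Matrix.submatrix_id_id]
    rw [hback]
    exact isHadamard_submatrix_equiv hW _
  · rintro ⟨a, b, c, d, hI⟩
    set A : ZMod 2 × ZMod 2 → ZMod n → ℤ := fun k r =>
      if k.1 = 0 then (if k.2 = 0 then a (-r) else c (-r)) else (if k.2 = 0 then b (-r) else d (-r)) with hA
    have z10 : (1 : ZMod 2) ≠ 0 := by decide
    have hA0 : (fun r => A (0, 0) (-r)) = a := by funext r; simp [hA]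
    have hA1 : (fun r => A (1, 0) (-r)) = b := by funext r; simp [hA, z10]
    have hA2 : (fun r => A (0, 1) (-r)) = c := by funext r; simp [hA, z10]
    have hA3 : (fun r => A (1, 1) (-r)) = d := by funext r; simp [hA, z10]
    refine ⟨A, ?_⟩
    rw [heq A, hA0, hA1, hA2, hA3]
    exact isHadamard_submatrix_equiv hI _

end anyorder

/-- **(∃ H(668) with σ₁₆₇, a centralising involution and a fixed-point-free inverting coset) ⇔ (∃ an Ito-type quadruple of
order 167: `itoMatrix a b c d` Hadamard of order 668).** -/
theorem hadamard668_ito_iff_itoMatrix :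
    (∃ (ι : Type) (_ : Fintype ι) (_ : DecidableEq ι) (H : Matrix ι ι ℤ) (π κ π₁ κ₁ π₂ κ₂ : Equiv.Perm ι)
        (d e d₁ e₁ d₂ e₂ : ι → ℤ) (μ : ℕ), Fintype.card ι = 668 ∧ IsHadamardMatrix H ∧ IsSignedAut H π κ d e ∧
        π ^ 167 = 1 ∧ κ ^ 167 = 1 ∧ (π ≠ 1 ∨ κ ≠ 1) ∧ IsSignedAut H π₁ κ₁ d₁ e₁ ∧ Commute π₁ π ∧ Commute κ₁ κ ∧
        π₁ ^ 2 = 1 ∧ κ₁ ^ 2 = 1 ∧ (π₁ ≠ 1 ∨ κ₁ ≠ 1) ∧ IsSignedAut H π₂ κ₂ d₂ e₂ ∧ π₂ * π = π ^ μ * π₂ ∧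
        κ₂ * κ = κ ^ μ * κ₂ ∧ μ % 167 = 166 ∧ (∀ x, π₂ x ≠ x) ∧ (∀ x, (π₂ * π₁) x ≠ x)) ↔
    ∃ a b c d : ZMod 167 → ℤ, IsHadamardMatrix (itoMatrix a b c d) :=
  hadamard668_ito_iff.trans itoThetaWArray_iff_itoMatrix

end Summit.Ventures.DiscreteObjects.Hadamard
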